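import Literature.MeasureTheory.Group.LocFiniteLIntegralProductTransfer        -- ★ (G-FUB) p852081 (F0P3a-p07 g19): `exists_nhds_setLIntegral_lt_top_iff_of_addEquiv`
import Mathlib.Analysis.Matrix.Normed
import Mathlib.LinearAlgebra.Matrix.Charpoly.Basic
import Mathlib.LinearAlgebra.Matrix.NonsingularInverse
import Mathlib.Topology.Algebra.ContinuousMonoidHom
import Mathlib.Tactic.NoncommRing
import HarnessLib

/-!
# F0 · P3c · line LH6 «StCharTS» — ROAD «HC-D» brick (ii-T) «TRANSPORT ALONG `Z ↦ g⁻¹ Z g`»: conjugation by an invertible `g` carries the skew algebra of `J` onto that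
# of the congruent form `(g.map σ)ᵀ J g`, the centraliser slice `𝔠(S₀)` onto `𝔠(g⁻¹ S₀ g)` as a `≃ₜ+`, and ball-finiteness of `∫⁻ f(S₀ + Z)` for a class function `f`

Cell `pub/hodgecm-mathlib`, crux H413 = `stmt-HodgeConjecture-24833` (lane `--supports … --as helper`), route HCCMUnconditional; seat F0P2-p06 (g18), brick (ii-T) of
the road «HC-D» of F0P2-p01 (g23) (deal: bus F0∕P2 2026-09-02T17:01:07Z; spec F0P3a-p05 (g23) 16:56:54Z «SPLIT ASK (2)»).  THEOREMS ONLY (no definition ∕ instance ∕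
notation ∕ named fact ∕ `sorry`); Mathlib + ★ (G-FUB) `Literature/MeasureTheory/Group/LocFiniteLIntegralProductTransfer`.

SETTING = F0P3a-p05's D5(ii) frame (★ `Theorems/F0P3cStCharTSHCDescentSemisimple*`): `K` a nontrivially normed field, matrices with the ELEMENTWISE norm
(`open scoped Matrix.Norms.Elementwise`, R1), `σ : K →+* K`, forms `J` and `J′ = (g.map σ)ᵀ * J * g` for an invertible `g` (`hg : IsUnit g.det`; `g` is a CHANGE OF
BASIS, not assumed unitary), the Lie algebras as `F`-submodules `𝔲`, `𝔲′ ≤ M_n(K)` with membership hypotheses `h𝔲 : X ∈ 𝔲 ↔ (X.map σ)ᵀ * J + J * X = 0`, `h𝔲′` (same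
with `J′`), and the centraliser slices `𝔠(S) = 𝔲 ⊓ ker (ad S)` spelled `𝔲 ⊓ (LinearMap.ker (LinearMap.mulLeft K S − LinearMap.mulRight K S)).restrictScalars F`.

* §1 algebra (any field): `conj_skew_of_skew` — `X` skew for `J` ⇒ `g⁻¹ X g` skew for `J′`; `map_transpose_mul_congr_mul_inv` — `((g⁻¹).map σ)ᵀ J′ g⁻¹ = J` (so the inverse
  conjugation goes back); `conj_comm_of_comm` — centralisers correspond; `charpoly_inv_conj` — `χ_{g⁻¹ X g} = χ_X`.
* §2 **`exists_conjEquiv_slice`** — `∃ T : ↥𝔠_J(S₀) ≃ₜ+ ↥𝔠_{J′}(g⁻¹ S₀ g)` with letters `T Z = g⁻¹ Z g`, `T.symm Z′ = g Z′ g⁻¹`.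
* §3 `exists_ball_iff_exists_nhds` — in a pseudo-metric space, «`∃ ρ > 0, P (closedBall x ρ)`» ⟺ «`∃ U ∈ 𝓝 x, P U`» for an ANTITONE property `P` (here: finiteness of `∫⁻_U`).
* §4 **`exists_ball_setLIntegral_lt_top_iff_conj`** — for ANY additive Haar measures `μ𝔠`, `μ𝔠′` on the two slices (Borel; the target locally compact second countable) and
  ANY `f : M_n(K) → ℝ≥0∞` with `charpoly X = charpoly Y → f X = f Y`:
  `(∃ ρ > 0, ∫⁻ Z in closedBall 0 ρ, f (S₀ + ↑Z) ∂μ𝔠 < ∞) ↔ (∃ ρ > 0, ∫⁻ Z in closedBall 0 ρ, f (g⁻¹ S₀ g + ↑Z) ∂μ𝔠′ < ∞)` — ★ (G-FUB) one-factor transfer along `T`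
  (Haar constant absorbed) + `f (g⁻¹ S₀ g + g⁻¹ Z g) = f (S₀ + Z)`; with the neighbourhood form `exists_nhds_setLIntegral_lt_top_iff_conj`.
Consumer: (ii-E) ∕ (ii-Q) of F0P3a-p05 (g23): the `𝔠`-integral of ★ `exists_nhds_setLIntegral_lt_top_of_slice` is evaluated in the NORMAL-FORM basis of (ii-B) (congruent
form `J′ = diagonal d`, `S₀′ = diagonal ![a,a,b]`) and moved back along this file.
HONEST LABEL: HC_CM is proved only modulo the 7 printed citations (2 remaining named inputs: hLiu418 = `stmt-HodgeConjecture-24832`, h413 = `stmt-HodgeConjecture-24833`)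
until rung 0 closes; this file closes no organ (count-neutral plumbing for the (HC-D) named input `hDGliO` of ★ RUNG0).

## References
* [HarishChandra1970] Harish-Chandra (notes by G. van Dijk), *Harmonic Analysis on Reductive p-adic Groups*, LNM 162 (1970), Part VI Lemma 22; Part VII §1 Thm. 15.
* [Folland1999] G. B. Folland, *Real Analysis*, 2nd ed. (1999), §11.1 Thm. 11.9 (uniqueness of Haar measure; transport along a topological isomorphism).
* [Rogawski1990] J. D. Rogawski, *Automorphic Representations of Unitary Groups in Three Variables*, Ann. of Math. Stud. 123 (1990), §1.9 p. 8, §4.9 p. 54.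
-/

set_option autoImplicit false
-- the mandated namespace has the single-problem summit's repeated segment (`HodgeConjecture.HodgeConjecture`)
set_option linter.dupNamespace false

open MeasureTheory Filter Metric Set Topology
open scoped Matrix Matrix.Norms.Elementwise Topology ENNReal

namespace Summit.HodgeConjecture.HodgeConjecture.Cruxes.H413.F0P3cStCharTSHCDSliceConjTransport

/-! ## §1 Algebra of the change of basis `X ↦ g⁻¹ X g` -/

section Algebra

variable {K : Type*} [Field K] {n : Type*} [Fintype n] [DecidableEq n] (σ : K →+* K)

/-- `((g⁻¹).map σ)ᵀ * (g.map σ)ᵀ = 1` for `det g` a unit. [cite: Rogawski1990, §1.9 p. 8] -/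
theorem map_inv_transpose_mul_map_transpose {g : Matrix n n K} (hg : IsUnit g.det) : ((g⁻¹).map σ)ᵀ * (g.map σ)ᵀ = 1 := by
  rw [← Matrix.transpose_mul, ← Matrix.map_mul, Matrix.mul_nonsing_inv g hg, Matrix.map_one σ (map_zero σ) (map_one σ), Matrix.transpose_one]

/-- `(g.map σ)ᵀ * ((g⁻¹).map σ)ᵀ = 1` for `det g` a unit. [cite: Rogawski1990, §1.9 p. 8] -/
theorem map_transpose_mul_map_inv_transpose {g : Matrix n n K} (hg : IsUnit g.det) : (g.map σ)ᵀ * ((g⁻¹).map σ)ᵀ = 1 := by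
  rw [← Matrix.transpose_mul, ← Matrix.map_mul, Matrix.nonsing_inv_mul g hg, Matrix.map_one σ (map_zero σ) (map_one σ), Matrix.transpose_one]

/-- **Skew goes to skew**: if `(X.map σ)ᵀ J + J X = 0` then `g⁻¹ X g` is skew for the congruent form `J′ = (g.map σ)ᵀ J g`. [cite: Rogawski1990, §1.9 p. 8] -/
theorem conj_skew_of_skew {J X g : Matrix n n K} (hg : IsUnit g.det) (hX : (X.map σ)ᵀ * J + J * X = 0) :
    ((g⁻¹ * X * g).map σ)ᵀ * ((g.map σ)ᵀ * J * g) + ((g.map σ)ᵀ * J * g) * (g⁻¹ * X * g) = 0 := by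
  rw [Matrix.map_mul, Matrix.map_mul, Matrix.transpose_mul, Matrix.transpose_mul]
  rw [show (g.map σ)ᵀ * ((X.map σ)ᵀ * ((g⁻¹).map σ)ᵀ) * ((g.map σ)ᵀ * J * g) + (g.map σ)ᵀ * J * g * (g⁻¹ * X * g) =
      (g.map σ)ᵀ * ((X.map σ)ᵀ * (((g⁻¹).map σ)ᵀ * (g.map σ)ᵀ) * J + J * (g * g⁻¹) * X) * g by noncomm_ring,
    map_inv_transpose_mul_map_transpose σ hg, Matrix.mul_nonsing_inv g hg, Matrix.mul_one, Matrix.mul_one, hX, Matrix.mul_zero, Matrix.zero_mul]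

/-- **The inverse change of basis recovers `J`**: `((g⁻¹).map σ)ᵀ * J′ * g⁻¹ = J` for `J′ = (g.map σ)ᵀ J g`. [cite: Rogawski1990, §1.9 p. 8] -/
theorem map_transpose_mul_congr_mul_inv {J g : Matrix n n K} (hg : IsUnit g.det) :
    ((g⁻¹).map σ)ᵀ * ((g.map σ)ᵀ * J * g) * g⁻¹ = J := by
  rw [show ((g⁻¹).map σ)ᵀ * ((g.map σ)ᵀ * J * g) * g⁻¹ = (((g⁻¹).map σ)ᵀ * (g.map σ)ᵀ) * J * (g * g⁻¹) by noncomm_ring,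
    map_inv_transpose_mul_map_transpose σ hg, Matrix.mul_nonsing_inv g hg, Matrix.one_mul, Matrix.mul_one]

/-- Centralisers correspond: `S Z = Z S → (h S g)(h Z g) = (h Z g)(h S g)` whenever `g h = 1`. [cite: Rogawski1990, §4.9 p. 54] -/
theorem conj_comm_of_comm_aux {S Z g h : Matrix n n K} (hgh : g * h = 1) (hc : S * Z = Z * S) :
    (h * S * g) * (h * Z * g) = (h * Z * g) * (h * S * g) := by
  rw [show (h * S * g) * (h * Z * g) = h * S * (g * h) * Z * g by noncomm_ring, hgh,
    show (h * Z * g) * (h * S * g) = h * Z * (g * h) * S * g by noncomm_ring, hgh, Matrix.mul_one, Matrix.mul_one,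
    Matrix.mul_assoc h S Z, hc, ← Matrix.mul_assoc]

/-- Centralisers correspond under `Z ↦ g⁻¹ Z g`. [cite: Rogawski1990, §4.9 p. 54] -/
theorem conj_comm_of_comm {S Z g : Matrix n n K} (hg : IsUnit g.det) (hc : S * Z = Z * S) :
    (g⁻¹ * S * g) * (g⁻¹ * Z * g) = (g⁻¹ * Z * g) * (g⁻¹ * S * g) :=
  conj_comm_of_comm_aux (Matrix.mul_nonsing_inv g hg) hc

/-- Centralisers correspond under `Z′ ↦ g Z′ g⁻¹`. [cite: Rogawski1990, §4.9 p. 54] -/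
theorem conj_comm_of_comm' {S Z g : Matrix n n K} (hg : IsUnit g.det) (hc : S * Z = Z * S) :
    (g * S * g⁻¹) * (g * Z * g⁻¹) = (g * Z * g⁻¹) * (g * S * g⁻¹) :=
  conj_comm_of_comm_aux (Matrix.nonsing_inv_mul g hg) hc

/-- `χ_{g⁻¹ X g} = χ_X` (Mathlib `charpoly_units_conj'` on `g.nonsingInvUnit`). [cite: Rogawski1990, §4.9 p. 54] -/
theorem charpoly_inv_conj {g : Matrix n n K} (hg : IsUnit g.det) (X : Matrix n n K) : (g⁻¹ * X * g).charpoly = X.charpoly :=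
  Matrix.charpoly_units_conj' (g.nonsingInvUnit hg) X

end Algebra

/-! ## §2 The slice isomorphism `T : 𝔠_J(S₀) ≃ₜ+ 𝔠_{J′}(g⁻¹ S₀ g)` -/

section Slice

variable {K : Type*} [NontriviallyNormedField K] {n : Type*} [Fintype n] [DecidableEq n] (σ : K →+* K)
  {F : Type*} [Field F] [Algebra F K]

/-- **The conjugation isomorphism of centraliser slices**: for `det g` a unit, `J′ = (g.map σ)ᵀ J g`, and `F`-submodules `𝔲`, `𝔲′` that ARE the skew algebras of `J`, `J′`,
the map `Z ↦ g⁻¹ Z g` is a `≃ₜ+` from `𝔲 ⊓ ker(ad S₀)` onto `𝔲′ ⊓ ker(ad (g⁻¹ S₀ g))`, with inverse `Z′ ↦ g Z′ g⁻¹`. [cite: HarishChandra1970, Part VI Lemma 22]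
[cite: Rogawski1990, §1.9 p. 8] -/
theorem exists_conjEquiv_slice {J J' g : Matrix n n K} (hg : IsUnit g.det) (hJ' : J' = (g.map σ)ᵀ * J * g)
    (𝔲 𝔲' : Submodule F (Matrix n n K)) (h𝔲 : ∀ X : Matrix n n K, X ∈ 𝔲 ↔ (X.map σ)ᵀ * J + J * X = 0)
    (h𝔲' : ∀ X : Matrix n n K, X ∈ 𝔲' ↔ (X.map σ)ᵀ * J' + J' * X = 0) (S₀ : Matrix n n K) :
    ∃ T : ↥(𝔲 ⊓ (LinearMap.ker (LinearMap.mulLeft K S₀ - LinearMap.mulRight K S₀ : Module.End K (Matrix n n K))).restrictScalars F) ≃ₜ+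
        ↥(𝔲' ⊓ (LinearMap.ker (LinearMap.mulLeft K (g⁻¹ * S₀ * g) - LinearMap.mulRight K (g⁻¹ * S₀ * g) : Module.End K (Matrix n n K))).restrictScalars F),
      (∀ Z, ((T Z : ↥(𝔲' ⊓ (LinearMap.ker (LinearMap.mulLeft K (g⁻¹ * S₀ * g) - LinearMap.mulRight K (g⁻¹ * S₀ * g) :
          Module.End K (Matrix n n K))).restrictScalars F)) : Matrix n n K) = g⁻¹ * (Z : Matrix n n K) * g) ∧
      (∀ Z', ((T.symm Z' : ↥(𝔲 ⊓ (LinearMap.ker (LinearMap.mulLeft K S₀ - LinearMap.mulRight K S₀ : Module.End K (Matrix n n K))).restrictScalars F)) :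
          Matrix n n K) = g * (Z' : Matrix n n K) * g⁻¹) := by
  have hinvinv : g⁻¹⁻¹ = g := Matrix.nonsing_inv_nonsing_inv g hg
  have hg' : IsUnit (g⁻¹).det := by rw [Matrix.det_nonsing_inv]; exact hg.ringInverse
  -- membership letters for the two slices
  have hmem : ∀ (S X : Matrix n n K) (𝔳 : Submodule F (Matrix n n K)),
      X ∈ 𝔳 ⊓ (LinearMap.ker (LinearMap.mulLeft K S - LinearMap.mulRight K S : Module.End K (Matrix n n K))).restrictScalars F ↔
        X ∈ 𝔳 ∧ S * X = X * S := by
    intro S X 𝔳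
    rw [Submodule.mem_inf, Submodule.restrictScalars_mem, LinearMap.mem_ker, LinearMap.sub_apply, LinearMap.mulLeft_apply, LinearMap.mulRight_apply, sub_eq_zero]
  have hfwd : ∀ Z : ↥(𝔲 ⊓ (LinearMap.ker (LinearMap.mulLeft K S₀ - LinearMap.mulRight K S₀ : Module.End K (Matrix n n K))).restrictScalars F),
      g⁻¹ * (Z : Matrix n n K) * g ∈
        𝔲' ⊓ (LinearMap.ker (LinearMap.mulLeft K (g⁻¹ * S₀ * g) - LinearMap.mulRight K (g⁻¹ * S₀ * g) : Module.End K (Matrix n n K))).restrictScalars F := by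
    intro Z
    obtain ⟨hZ, hc⟩ := (hmem _ _ _).1 Z.2
    refine (hmem _ _ _).2 ⟨(h𝔲' _).2 ?_, conj_comm_of_comm hg hc⟩
    rw [hJ']
    exact conj_skew_of_skew σ hg ((h𝔲 _).1 hZ)
  have hbwd : ∀ Z' : ↥(𝔲' ⊓ (LinearMap.ker (LinearMap.mulLeft K (g⁻¹ * S₀ * g) - LinearMap.mulRight K (g⁻¹ * S₀ * g) : Module.End K (Matrix n n K))).restrictScalars F),
      g * (Z' : Matrix n n K) * g⁻¹ ∈ 𝔲 ⊓ (LinearMap.ker (LinearMap.mulLeft K S₀ - LinearMap.mulRight K S₀ : Module.End K (Matrix n n K))).restrictScalars F := by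
    intro Z'
    obtain ⟨hZ', hc'⟩ := (hmem _ _ _).1 Z'.2
    refine (hmem _ _ _).2 ⟨(h𝔲 _).2 ?_, ?_⟩
    · -- skew for `J′` ⇒ `g⁻¹⁻¹ Z′ g⁻¹` skew for `((g⁻¹).map σ)ᵀ J′ g⁻¹ = J`
      have h := conj_skew_of_skew σ hg' ((h𝔲' _).1 hZ')
      rw [hinvinv, hJ', map_transpose_mul_congr_mul_inv σ hg] at h
      exact h
    · have h := conj_comm_of_comm' hg hc'
      rwa [show g * (g⁻¹ * S₀ * g) * g⁻¹ = (g * g⁻¹) * S₀ * (g * g⁻¹) by noncomm_ring, Matrix.mul_nonsing_inv g hg, Matrix.one_mul,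
        Matrix.mul_one] at h
  refine ⟨{ toFun := fun Z => ⟨g⁻¹ * (Z : Matrix n n K) * g, hfwd Z⟩
            invFun := fun Z' => ⟨g * (Z' : Matrix n n K) * g⁻¹, hbwd Z'⟩
            left_inv := fun Z => Subtype.ext (by
              change g * (g⁻¹ * (Z : Matrix n n K) * g) * g⁻¹ = Z
              rw [show g * (g⁻¹ * (Z : Matrix n n K) * g) * g⁻¹ = (g * g⁻¹) * (Z : Matrix n n K) * (g * g⁻¹) by noncomm_ring,
                Matrix.mul_nonsing_inv g hg, Matrix.one_mul, Matrix.mul_one])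
            right_inv := fun Z' => Subtype.ext (by
              change g⁻¹ * (g * (Z' : Matrix n n K) * g⁻¹) * g = Z'
              rw [show g⁻¹ * (g * (Z' : Matrix n n K) * g⁻¹) * g = (g⁻¹ * g) * (Z' : Matrix n n K) * (g⁻¹ * g) by noncomm_ring,
                Matrix.nonsing_inv_mul g hg, Matrix.one_mul, Matrix.mul_one])
            map_add' := fun Z W => Subtype.ext (by
              change g⁻¹ * ((Z : Matrix n n K) + W) * g = g⁻¹ * (Z : Matrix n n K) * g + g⁻¹ * (W : Matrix n n K) * g
              rw [Matrix.mul_add, Matrix.add_mul])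
            continuous_toFun := ((continuous_const.matrix_mul continuous_subtype_val).matrix_mul continuous_const).subtype_mk _
            continuous_invFun := ((continuous_const.matrix_mul continuous_subtype_val).matrix_mul continuous_const).subtype_mk _ },
    fun Z => rfl, fun Z' => rfl⟩

end Slice

/-! ## §3 Balls versus neighbourhoods for an antitone property -/

/-- In a pseudo-metric space, «some closed ball around `x` has property `P`» ⟺ «some neighbourhood of `x` has `P`», for `P` ANTITONE (e.g. `P U := ∫⁻_U f < ∞`).
[cite: Folland1999, §11.1 Thm. 11.9] -/
theorem exists_ball_iff_exists_nhds {X : Type*} [PseudoMetricSpace X] (x : X) (P : Set X → Prop) (hP : ∀ s t : Set X, s ⊆ t → P t → P s) :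
    (∃ ρ : ℝ, 0 < ρ ∧ P (closedBall x ρ)) ↔ ∃ U ∈ 𝓝 x, P U := by
  constructor
  · rintro ⟨ρ, hρ, h⟩
    exact ⟨closedBall x ρ, closedBall_mem_nhds x hρ, h⟩
  · rintro ⟨U, hU, h⟩
    obtain ⟨ε, hε, hεU⟩ := Metric.mem_nhds_iff.1 hU
    exact ⟨ε / 2, half_pos hε, hP _ _ ((closedBall_subset_ball (half_lt_self hε)).trans hεU) h⟩

/-! ## §4 Transfer of ball-finiteness of `∫⁻ f(S₀ + Z)` along the change of basis -/

section Transfer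

variable {K : Type*} [NontriviallyNormedField K] {n : Type*} [Fintype n] [DecidableEq n] (σ : K →+* K)
  {F : Type*} [Field F] [Algebra F K]

/-- **TRANSPORT ALONG `Z ↦ g⁻¹ Z g`, neighbourhood form**: for ANY additive Haar measures `μ𝔠` on `𝔠_J(S₀)` and `μ𝔠′` on `𝔠_{J′}(g⁻¹ S₀ g)` (the latter locally compact and
second countable) and ANY class function `f` (`charpoly X = charpoly Y → f X = f Y`), `f (S₀ + ·)` has finite integral near `0` in `𝔠_J(S₀)` iff `f (g⁻¹ S₀ g + ·)` has finite
integral near `0` in `𝔠_{J′}(g⁻¹ S₀ g)`. [cite: HarishChandra1970, Part VI Lemma 22] [cite: Folland1999, §11.1 Thm. 11.9] -/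
theorem exists_nhds_setLIntegral_lt_top_iff_conj {J J' g : Matrix n n K} (hg : IsUnit g.det) (hJ' : J' = (g.map σ)ᵀ * J * g)
    (𝔲 𝔲' : Submodule F (Matrix n n K)) (h𝔲 : ∀ X : Matrix n n K, X ∈ 𝔲 ↔ (X.map σ)ᵀ * J + J * X = 0)
    (h𝔲' : ∀ X : Matrix n n K, X ∈ 𝔲' ↔ (X.map σ)ᵀ * J' + J' * X = 0) (S₀ : Matrix n n K)
    [MeasurableSpace ↥(𝔲 ⊓ (LinearMap.ker (LinearMap.mulLeft K S₀ - LinearMap.mulRight K S₀ : Module.End K (Matrix n n K))).restrictScalars F)]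
    [BorelSpace ↥(𝔲 ⊓ (LinearMap.ker (LinearMap.mulLeft K S₀ - LinearMap.mulRight K S₀ : Module.End K (Matrix n n K))).restrictScalars F)]
    [MeasurableSpace ↥(𝔲' ⊓ (LinearMap.ker (LinearMap.mulLeft K (g⁻¹ * S₀ * g) - LinearMap.mulRight K (g⁻¹ * S₀ * g) : Module.End K (Matrix n n K))).restrictScalars F)]
    [BorelSpace ↥(𝔲' ⊓ (LinearMap.ker (LinearMap.mulLeft K (g⁻¹ * S₀ * g) - LinearMap.mulRight K (g⁻¹ * S₀ * g) : Module.End K (Matrix n n K))).restrictScalars F)]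
    [LocallyCompactSpace ↥(𝔲' ⊓ (LinearMap.ker (LinearMap.mulLeft K (g⁻¹ * S₀ * g) - LinearMap.mulRight K (g⁻¹ * S₀ * g) : Module.End K (Matrix n n K))).restrictScalars F)]
    [SecondCountableTopology ↥(𝔲' ⊓ (LinearMap.ker (LinearMap.mulLeft K (g⁻¹ * S₀ * g) - LinearMap.mulRight K (g⁻¹ * S₀ * g) : Module.End K (Matrix n n K))).restrictScalars F)]
    (μ𝔠 : Measure ↥(𝔲 ⊓ (LinearMap.ker (LinearMap.mulLeft K S₀ - LinearMap.mulRight K S₀ : Module.End K (Matrix n n K))).restrictScalars F)) [μ𝔠.IsAddHaarMeasure]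
    (μ𝔠' : Measure ↥(𝔲' ⊓ (LinearMap.ker (LinearMap.mulLeft K (g⁻¹ * S₀ * g) - LinearMap.mulRight K (g⁻¹ * S₀ * g) : Module.End K (Matrix n n K))).restrictScalars F))
    [μ𝔠'.IsAddHaarMeasure]
    (f : Matrix n n K → ℝ≥0∞) (hf : ∀ X Y : Matrix n n K, X.charpoly = Y.charpoly → f X = f Y) :
    (∃ U ∈ 𝓝 (0 : ↥(𝔲 ⊓ (LinearMap.ker (LinearMap.mulLeft K S₀ - LinearMap.mulRight K S₀ : Module.End K (Matrix n n K))).restrictScalars F)),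
        ∫⁻ Z in U, f (S₀ + (Z : Matrix n n K)) ∂μ𝔠 < ∞) ↔
      (∃ U ∈ 𝓝 (0 : ↥(𝔲' ⊓ (LinearMap.ker (LinearMap.mulLeft K (g⁻¹ * S₀ * g) - LinearMap.mulRight K (g⁻¹ * S₀ * g) :
          Module.End K (Matrix n n K))).restrictScalars F)),
        ∫⁻ Z in U, f (g⁻¹ * S₀ * g + (Z : Matrix n n K)) ∂μ𝔠' < ∞) := by
  obtain ⟨T, hT, -⟩ := exists_conjEquiv_slice σ hg hJ' 𝔲 𝔲' h𝔲 h𝔲' S₀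
  have key := Literature.MeasureTheory.Group.exists_nhds_setLIntegral_lt_top_iff_of_addEquiv T μ𝔠 μ𝔠'
    (fun Z' => f (g⁻¹ * S₀ * g + (Z' : Matrix n n K))) 0
  rw [map_zero] at key
  have hcomp : ∀ Z : ↥(𝔲 ⊓ (LinearMap.ker (LinearMap.mulLeft K S₀ - LinearMap.mulRight K S₀ : Module.End K (Matrix n n K))).restrictScalars F),
      f (g⁻¹ * S₀ * g + ((T Z : ↥(𝔲' ⊓ (LinearMap.ker (LinearMap.mulLeft K (g⁻¹ * S₀ * g) - LinearMap.mulRight K (g⁻¹ * S₀ * g) :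
        Module.End K (Matrix n n K))).restrictScalars F)) : Matrix n n K)) = f (S₀ + (Z : Matrix n n K)) := by
    intro Z
    rw [hT]
    refine hf _ _ ?_
    rw [show g⁻¹ * S₀ * g + g⁻¹ * (Z : Matrix n n K) * g = g⁻¹ * (S₀ + (Z : Matrix n n K)) * g by rw [Matrix.mul_add, Matrix.add_mul],
      charpoly_inv_conj hg]
  simp only [hcomp] at key
  exact key.symm

/-- **TRANSPORT ALONG `Z ↦ g⁻¹ Z g`, ball form** (F0P3a-p05's socket): same hypotheses;
`(∃ ρ > 0, ∫⁻ Z in closedBall 0 ρ, f (S₀ + ↑Z) ∂μ𝔠 < ∞) ↔ (∃ ρ > 0, ∫⁻ Z in closedBall 0 ρ, f (g⁻¹ S₀ g + ↑Z) ∂μ𝔠′ < ∞)` (elementwise norms on the slices).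
[cite: HarishChandra1970, Part VI Lemma 22] [cite: Folland1999, §11.1 Thm. 11.9] -/
theorem exists_ball_setLIntegral_lt_top_iff_conj {J J' g : Matrix n n K} (hg : IsUnit g.det) (hJ' : J' = (g.map σ)ᵀ * J * g)
    (𝔲 𝔲' : Submodule F (Matrix n n K)) (h𝔲 : ∀ X : Matrix n n K, X ∈ 𝔲 ↔ (X.map σ)ᵀ * J + J * X = 0)
    (h𝔲' : ∀ X : Matrix n n K, X ∈ 𝔲' ↔ (X.map σ)ᵀ * J' + J' * X = 0) (S₀ : Matrix n n K)
    [MeasurableSpace ↥(𝔲 ⊓ (LinearMap.ker (LinearMap.mulLeft K S₀ - LinearMap.mulRight K S₀ : Module.End K (Matrix n n K))).restrictScalars F)]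
    [BorelSpace ↥(𝔲 ⊓ (LinearMap.ker (LinearMap.mulLeft K S₀ - LinearMap.mulRight K S₀ : Module.End K (Matrix n n K))).restrictScalars F)]
    [MeasurableSpace ↥(𝔲' ⊓ (LinearMap.ker (LinearMap.mulLeft K (g⁻¹ * S₀ * g) - LinearMap.mulRight K (g⁻¹ * S₀ * g) : Module.End K (Matrix n n K))).restrictScalars F)]
    [BorelSpace ↥(𝔲' ⊓ (LinearMap.ker (LinearMap.mulLeft K (g⁻¹ * S₀ * g) - LinearMap.mulRight K (g⁻¹ * S₀ * g) : Module.End K (Matrix n n K))).restrictScalars F)]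
    [LocallyCompactSpace ↥(𝔲' ⊓ (LinearMap.ker (LinearMap.mulLeft K (g⁻¹ * S₀ * g) - LinearMap.mulRight K (g⁻¹ * S₀ * g) : Module.End K (Matrix n n K))).restrictScalars F)]
    [SecondCountableTopology ↥(𝔲' ⊓ (LinearMap.ker (LinearMap.mulLeft K (g⁻¹ * S₀ * g) - LinearMap.mulRight K (g⁻¹ * S₀ * g) : Module.End K (Matrix n n K))).restrictScalars F)]
    (μ𝔠 : Measure ↥(𝔲 ⊓ (LinearMap.ker (LinearMap.mulLeft K S₀ - LinearMap.mulRight K S₀ : Module.End K (Matrix n n K))).restrictScalars F)) [μ𝔠.IsAddHaarMeasure]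
    (μ𝔠' : Measure ↥(𝔲' ⊓ (LinearMap.ker (LinearMap.mulLeft K (g⁻¹ * S₀ * g) - LinearMap.mulRight K (g⁻¹ * S₀ * g) : Module.End K (Matrix n n K))).restrictScalars F))
    [μ𝔠'.IsAddHaarMeasure]
    (f : Matrix n n K → ℝ≥0∞) (hf : ∀ X Y : Matrix n n K, X.charpoly = Y.charpoly → f X = f Y) :
    (∃ ρ : ℝ, 0 < ρ ∧ ∫⁻ Z in closedBall (0 : ↥(𝔲 ⊓ (LinearMap.ker (LinearMap.mulLeft K S₀ - LinearMap.mulRight K S₀ : Module.End K (Matrix n n K))).restrictScalars F)) ρ,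
        f (S₀ + (Z : Matrix n n K)) ∂μ𝔠 < ∞) ↔
      (∃ ρ : ℝ, 0 < ρ ∧ ∫⁻ Z in closedBall (0 : ↥(𝔲' ⊓ (LinearMap.ker (LinearMap.mulLeft K (g⁻¹ * S₀ * g) - LinearMap.mulRight K (g⁻¹ * S₀ * g) :
          Module.End K (Matrix n n K))).restrictScalars F)) ρ,
        f (g⁻¹ * S₀ * g + (Z : Matrix n n K)) ∂μ𝔠' < ∞) := by
  rw [exists_ball_iff_exists_nhds (0 : ↥(𝔲 ⊓ (LinearMap.ker (LinearMap.mulLeft K S₀ - LinearMap.mulRight K S₀ : Module.End K (Matrix n n K))).restrictScalars F))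
      (fun U => ∫⁻ Z in U, f (S₀ + (Z : Matrix n n K)) ∂μ𝔠 < ∞) (fun s t hst h => (lintegral_mono_set hst).trans_lt h),
    exists_ball_iff_exists_nhds (0 : ↥(𝔲' ⊓ (LinearMap.ker (LinearMap.mulLeft K (g⁻¹ * S₀ * g) - LinearMap.mulRight K (g⁻¹ * S₀ * g) :
          Module.End K (Matrix n n K))).restrictScalars F))
      (fun U => ∫⁻ Z in U, f (g⁻¹ * S₀ * g + (Z : Matrix n n K)) ∂μ𝔠' < ∞) (fun s t hst h => (lintegral_mono_set hst).trans_lt h)]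
  exact exists_nhds_setLIntegral_lt_top_iff_conj σ hg hJ' 𝔲 𝔲' h𝔲 h𝔲' S₀ μ𝔠 μ𝔠' f hf

end Transfer

end Summit.HodgeConjecture.HodgeConjecture.Cruxes.H413.F0P3cStCharTSHCDSliceConjTransport
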